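import Summits.Ventures.CertifiedArithmetic.LowPrec.UfpN
import Summits.Ventures.CertifiedArithmetic.LowPrec.CompensatedSum

/-!
# The Lange–Rump sharp constant for the formats: any-order summation error `≤ k·u/(1+k·u)·Σ|xᵢ|`

HONEST FRAMING (venture CertifiedArithmetic / cell `pub-lowprec`): certified error envelopes and
provably optimal rounding/accumulation schemes for low-precision formats under stated cost models;
every table by two implementations; no hardware or vendor claims.

THE THEOREM (statement: [LangeRump2018] = Lange–Rump, *Sharp estimates for perturbation errors in
summations*, Math. Comp. 88 (2019); quoted as [BoldoEtAl2023, Thm 4.5]): for `x₁ … xₙ ∈ F`,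
round-to-nearest and ANY summation ordering (binary evaluation tree with `k = n - 1` additions),
IF `k ≤ ½ u⁻¹` then `|ŝ - s| ≤ k·u/(1 + k·u) · Σ|xᵢ|`; the bound is attained (recursive summation of
`(1, u, …, u)` with ties-to-even). It sharpens the Jeannerod–Rump constant `k·u/(1+u)`
(`AccumulateSharp.lean`) and is the "Theorem LR" the cell's GEMM note cites for the exact worst case
`W(n) = (n-1)u/(1+(n-1)u)` of FP8/FP6/FP4 inner products on `2 ≤ n ≤ ½u⁻¹ + 1`.

PROVED HERE for the venture's bit-level formats (`roundNE α`, saturating, subnormals; every format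
with `emaxCode ≥ 2`; leaves in `F_α`; every node's exact argument in range): the stronger
local-error form `Σ_nodes |e_v| ≤ k·u/(1+k·u) · Σ|xᵢ|` (`absErr_flα_le_langeRump`) and the headline
`|ŝ - s| ≤ k·u/(1+k·u) · Σ|xᵢ|` (`abs_eval_sub_exact_le_langeRump`); the sequential corollary for the cell's
`seqSum` accumulations, `|ŝₙ - Σ_{i≤n} xᵢ| ≤ n·u/(1+n·u) · Σ_{i≤n}|xᵢ|` (`abs_seqSum_sub_sum_le_langeRump`).

THE PROOF is NOT the published one (the primary is not held by the hub; the secondary source states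
the theorem without proof). It is a short self-contained argument found for this file, by strong
induction over the tree, organised around `U := max_v ufp(y_v)` over the internal nodes `v`
(`y_v` = exact argument of node `v`; `ufpN` (UfpN.lean) is `ufp` on the rounding range and `0` on the
exact range `|y| < 2^(m+1)·quantum`). Pick a node `v₁` with `ufp(y_{v₁}) = U` none of whose proper
descendants attains `U`. Then (1) every node strictly below `v₁` errs by `≤ u·U/2`, so their total
is `D₀ ≤ m·u·U/2` (`m` nodes); (2) `U ∈ F` lies at distance `≥ |e_{v₁}|` from `y_{v₁}`, so the leaf
mass below `v₁` is `≥ |s_{v₁}| ≥ U + |e_{v₁}| - D₀`; (3) each ancestor `w` of `v₁` adds a float to the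
evaluated value `b̂` of a disjoint subtree `B`, so `|e_w| ≤ min(|b̂|, u·U) ≤ min(T_B + D_B, u·U)` with
`D_B ≤ k_B u/(1+k_B u)·T_B` by induction; (4) bookkeeping: with `θ = K u/(1+K u)` the quantity
`D - θ·T` is `≤ -(K - k)·u·U/(1+K u)` for the subtree at `v₁` (this uses `2·K·u ≤ 1` exactly once,
as `(1 + 2Ku)·D₀ ≤ 2·D₀`) and each ancestor step consumes exactly `(k_B + 1)·u·U/(1+Ku)` of that
slack, so `D ≤ θ·T` at the root. Brute-force cross-check before formalisation: precision 3,
`n = 5` (`k = ½u⁻¹`), all three tree shapes, 4.0·10⁶ leaf tuples: 0 violations, ratio 1 attained.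

Not here: the height form `h·u` [BoldoEtAl2023, Thm 4.4], faithful rounding [BoldoEtAl2023,
Thm 4.3], attainment for every `n` (a kernel example is given), necessity of `k ≤ ½u⁻¹`.
-/

namespace Literature.ComputerArithmetic.FloatingPoint

namespace MiniFloat

open Literature.ComputerArithmetic.JeannerodRump2018
open Literature.ComputerArithmetic.JeannerodRump2018.SumTree

variable {α : Format}

/-! ### The induction: spine invariant and the theorem -/

/-- THE INDUCTION. For every evaluation tree `t` (leaves in `F_α`, nodes in range), jointly:
(B) SPINE INVARIANT — for every `K ≥ numNodes t` with `2Ku ≤ 1` and every cap `U` bounding all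
binade floors of `t` and attained at some node of `t`:
`Σ|e_v| - K u/(1+K u)·Σ|xᵢ| ≤ -(K - numNodes t)·u·U/(1+K u)`;
(A) THE BOUND — if `2·numNodes t·u ≤ 1` then `Σ|e_v| ≤ k u/(1+k u)·Σ|xᵢ|`, `k = numNodes t`.
(B) for a node uses (B) for the child containing a maximal node and (A) for the other child
(`langeRump_step_arith`), or, when only the root is maximal, the cap lemma at `U/2` on both
children (`langeRump_base_arith`); (A) is (B) at `K = numNodes t`, `U = maxUfp`. [folklore] -/
theorem langeRump_induction (hα : 2 ≤ α.emaxCode) :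
    ∀ t : SumTree, TreeInRange α t →
      (∀ (K : ℕ) (U : ℚ), numNodes t ≤ K → 2 * (K : ℚ) * α.unitRoundoff ≤ 1 →
          AllNodes α (fun y => ufpN α y ≤ U) t → SomeNode α (fun y => ufpN α y = U) t →
          absErr (flα α) t
              - (K : ℚ) * α.unitRoundoff / (1 + (K : ℚ) * α.unitRoundoff) * absSum t
            ≤ -(((K : ℚ) - numNodes t) * (α.unitRoundoff * U)
                / (1 + (K : ℚ) * α.unitRoundoff))) ∧
      (2 * (numNodes t : ℚ) * α.unitRoundoff ≤ 1 →
          absErr (flα α) t ≤ (numNodes t : ℚ) * α.unitRoundoff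
            / (1 + (numNodes t : ℚ) * α.unitRoundoff) * absSum t)
  | .leaf x, _ => by
      refine ⟨fun K U _ _ _ hS => hS.elim, fun _ => ?_⟩
      simp [absErr, SumTree.localErrors, numNodes, absSum, SumTree.leaves]
  | .node l r, ⟨hl, hr, hrange⟩ => by
      obtain ⟨Bl, Al⟩ := langeRump_induction hα l hl
      obtain ⟨Br, Ar⟩ := langeRump_induction hα r hr
      have hu := α.unitRoundoff_pos
      have hu2 : 2 * α.unitRoundoff ≤ 1 := by
        rw [Format.unitRoundoff_eq, pow_succ]
        have : (1 : ℚ) ≤ 2 ^ α.manBits := one_le_pow₀ (by norm_num)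
        rw [mul_one_div, div_le_one (by positivity)]
        nlinarith
      set u := α.unitRoundoff with hu_def
      -- the node's data
      obtain ⟨yl, hyl⟩ := exists_toRat_eq_eval l hl
      obtain ⟨yr, hyr⟩ := exists_toRat_eq_eval r hr
      have hrange' : |yl.toRat + yr.toRat| ≤ α.maxRat := by rw [hyl, hyr]; exact hrange
      set y := SumTree.eval (flα α) l + SumTree.eval (flα α) r with hy_def
      set e := |flα α y - y| with he_def
      set Dl := absErr (flα α) l
      set Dr := absErr (flα α) r
      set Tl := absSum l
      set Tr := absSum r
      have hDl := absErr_nonneg (flα α) l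
      have hDr := absErr_nonneg (flα α) r
      have hTl := absSum_nonneg l
      have hTr := absSum_nonneg r
      -- local facts at the root
      have he_ufp : e ≤ u * ufpN α y := by
        have := abs_err_roundNE_add_le_ufpN hα yl yr hrange'
        rw [hyl, hyr] at this; exact this
      have he_r : e ≤ |SumTree.eval (flα α) r| := by
        have := abs_err_roundNE_add_le_abs yl yr
        rw [hyl, hyr] at this; exact this
      have he_l : e ≤ |SumTree.eval (flα α) l| := by
        have := abs_err_roundNE_add_le_abs yr yl
        rw [hyl, hyr, add_comm (SumTree.eval (flα α) r)] at this; exact this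
      have he_fit : e + ufpN α y ≤ |y| := by
        have := abs_err_add_ufpN_le_abs yl yr hrange'
        rw [hyl, hyr] at this; exact this
      have har_le : |SumTree.eval (flα α) r| ≤ Tr + Dr := abs_eval_le (flα α) r
      have hal_le : |SumTree.eval (flα α) l| ≤ Tl + Dl := abs_eval_le (flα α) l
      have hnode : (numNodes (SumTree.node l r) : ℚ) = numNodes l + numNodes r + 1 := by
        simp [numNodes]
      have hEnode : absErr (flα α) (SumTree.node l r) = Dl + Dr + e := absErr_node _ _ _
      have hTnode : absSum (SumTree.node l r) = Tl + Tr := absSum_node _ _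
      -- (B)
      have hB : ∀ (K : ℕ) (U : ℚ), numNodes (SumTree.node l r) ≤ K → 2 * (K : ℚ) * u ≤ 1 →
          AllNodes α (fun y => ufpN α y ≤ U) (.node l r) →
          SomeNode α (fun y => ufpN α y = U) (.node l r) →
          absErr (flα α) (.node l r) - (K : ℚ) * u / (1 + (K : ℚ) * u) * absSum (.node l r)
            ≤ -(((K : ℚ) - numNodes (SumTree.node l r)) * (u * U) / (1 + (K : ℚ) * u)) := by
        intro K U hK hKu hAll hSome
        obtain ⟨hal, har, hroot⟩ := hAll
        have hK' : numNodes l + numNodes r + 1 ≤ K := by simpa [numNodes] using hK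
        have hU : 0 ≤ U := le_trans (ufpN_nonneg α y) hroot
        have he_U : e ≤ u * U := le_trans he_ufp (mul_le_mul_of_nonneg_left hroot hu.le)
        rw [hEnode, hTnode, hnode]
        set w := u * U / (1 + (K : ℚ) * u) with hw
        by_cases hsl : SomeNode α (fun y => ufpN α y = U) l
        · -- spine through `l`; `r` hangs
          have h1 := Bl K U (by omega) hKu hal hsl
          have hkr : 2 * (numNodes r : ℚ) * u ≤ 1 := by
            have : (numNodes r : ℚ) ≤ K := by exact_mod_cast (by omega : numNodes r ≤ K)
            nlinarith
          have h2 := langeRump_step_arith (kB := numNodes r) (K := K) hu hu2 hU hKu (by omega)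
            hTr hDr (Ar hkr) (le_trans he_r har_le) he_U
          have e1 : Dl + Dr + e - (K : ℚ) * u / (1 + (K : ℚ) * u) * (Tl + Tr)
              = (Dl - (K : ℚ) * u / (1 + (K : ℚ) * u) * Tl)
                + (Dr + e - (K : ℚ) * u / (1 + (K : ℚ) * u) * Tr) := by ring
          have e2 : -(((K : ℚ) - numNodes l) * (u * U) / (1 + (K : ℚ) * u))
                + ((numNodes r : ℚ) + 1) * (u * U) / (1 + (K : ℚ) * u)
              = -(((K : ℚ) - (numNodes l + numNodes r + 1)) * (u * U) / (1 + (K : ℚ) * u)) := by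
            ring
          rw [e1, ← e2]
          exact add_le_add h1 h2
        by_cases hsr : SomeNode α (fun y => ufpN α y = U) r
        · -- spine through `r`; `l` hangs
          have h1 := Br K U (by omega) hKu har hsr
          have hkl : 2 * (numNodes l : ℚ) * u ≤ 1 := by
            have : (numNodes l : ℚ) ≤ K := by exact_mod_cast (by omega : numNodes l ≤ K)
            nlinarith
          have h2 := langeRump_step_arith (kB := numNodes l) (K := K) hu hu2 hU hKu (by omega)
            hTl hDl (Al hkl) (le_trans he_l hal_le) he_U
          have e1 : Dl + Dr + e - (K : ℚ) * u / (1 + (K : ℚ) * u) * (Tl + Tr)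
              = (Dr - (K : ℚ) * u / (1 + (K : ℚ) * u) * Tr)
                + (Dl + e - (K : ℚ) * u / (1 + (K : ℚ) * u) * Tl) := by ring
          have e2 : -(((K : ℚ) - numNodes r) * (u * U) / (1 + (K : ℚ) * u))
                + ((numNodes l : ℚ) + 1) * (u * U) / (1 + (K : ℚ) * u)
              = -(((K : ℚ) - (numNodes l + numNodes r + 1)) * (u * U) / (1 + (K : ℚ) * u)) := by
            ring
          rw [e1, ← e2]
          exact add_le_add h1 h2
        · -- only the root is maximal: both children live below the cap U/2
          have hroot_eq : ufpN α y = U := by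
            rcases hSome with h | h | h
            · exact absurd h hsl
            · exact absurd h hsr
            · exact h
          have below : ∀ {t : SumTree}, AllNodes α (fun y => ufpN α y ≤ U) t →
              ¬ SomeNode α (fun y => ufpN α y = U) t →
              AllNodes α (fun y => ufpN α y ≤ U / 2) t := by
            intro t h1 h2
            refine AllNodes.mono (fun z hz => ?_) t (AllNodes.and_not t h1 h2)
            have hlt : ufpN α z < ufpN α y := by
              rw [hroot_eq]; exact lt_of_le_of_ne hz.1 hz.2
            have := two_mul_ufpN_le_of_lt hlt
            rw [hroot_eq] at this
            linarith
          have cl := absErr_le_numNodes_mul hα l hl (below hal hsl)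
          have cr := absErr_le_numNodes_mul hα r hr (below har hsr)
          have hD₀ : Dl + Dr ≤ ((numNodes l + numNodes r : ℕ) : ℚ) * (u * (U / 2)) := by
            push_cast; linarith
          -- leaf mass below the root: T ≥ |exact| ≥ |y| - Dl - Dr ≥ U + e - (Dl + Dr)
          have hT : U + e - (Dl + Dr) ≤ Tl + Tr := by
            have h1 : |SumTree.exact l + SumTree.exact r| ≤ Tl + Tr := by
              rw [← absSum_node]; exact abs_exact_le_absSum (.node l r)
            have h2 := abs_eval_sub_exact_le (flα α) l
            have h3 := abs_eval_sub_exact_le (flα α) r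
            have h4 : |y| ≤ |SumTree.exact l + SumTree.exact r| + Dl + Dr := by
              have : y = (SumTree.exact l + SumTree.exact r)
                  + ((SumTree.eval (flα α) l - SumTree.exact l)
                    + (SumTree.eval (flα α) r - SumTree.exact r)) := by rw [hy_def]; ring
              rw [this]
              refine le_trans (abs_add_le _ _) ?_
              have := abs_add_le (SumTree.eval (flα α) l - SumTree.exact l)
                (SumTree.eval (flα α) r - SumTree.exact r)
              linarith
            rw [hroot_eq] at he_fit
            linarith
          have := langeRump_base_arith (m := numNodes l + numNodes r) (K := K) hu hKu
            (by omega) (add_nonneg hDl hDr) hD₀ he_U hT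
          push_cast at this
          linarith
      refine ⟨hB, fun hk => ?_⟩
      -- (A) from (B) at K = numNodes, U = maxUfp
      have := hB (numNodes (.node l r)) (maxUfp α (.node l r)) le_rfl hk
        (allNodes_ufpN_le_maxUfp _) (someNode_ufpN_eq_maxUfp _ (by simp [numNodes]))
      simp only [sub_self, zero_mul, zero_div, neg_zero, sub_nonpos] at this
      exact this

/-- LANGE–RUMP FOR THE FORMATS, local-error form: for every format `α` with `emaxCode ≥ 2` and
every evaluation tree with leaves in `F_α`, nodes in range and `k = n - 1 ≤ ½u⁻¹` additions,
`Σ|eᵢ| ≤ k·u/(1 + k·u) · Σ|xᵢ|`. [cite: BoldoEtAl2023, Thm 4.5] -/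
theorem absErr_flα_le_langeRump (hα : 2 ≤ α.emaxCode) (t : SumTree) (ht : TreeInRange α t)
    (hk : 2 * ((t.leaves.length : ℚ) - 1) * α.unitRoundoff ≤ 1) :
    absErr (flα α) t ≤ ((t.leaves.length : ℚ) - 1) * α.unitRoundoff
      / (1 + ((t.leaves.length : ℚ) - 1) * α.unitRoundoff) * absSum t := by
  rw [← numNodes_cast] at hk ⊢
  exact (langeRump_induction hα t ht).2 hk

/-- LANGE–RUMP FOR THE FORMATS (R2, any order, the sharp constant): for every format `α` with
`emaxCode ≥ 2`, every evaluation tree (sequential, pairwise, blocked, …) with leaves in `F_α`,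
nodes in range and `n - 1 ≤ ½u⁻¹`: `|ŝ - s| ≤ (n-1)·u/(1 + (n-1)·u) · Σ|xᵢ|`. Statement:
Lange–Rump 2019 [LangeRump2018], as quoted in [BoldoEtAl2023, Thm 4.5]; proof: this file.
[cite: BoldoEtAl2023, Thm 4.5] -/
theorem abs_eval_sub_exact_le_langeRump (hα : 2 ≤ α.emaxCode) (t : SumTree)
    (ht : TreeInRange α t) (hk : 2 * ((t.leaves.length : ℚ) - 1) * α.unitRoundoff ≤ 1) :
    |SumTree.eval (flα α) t - SumTree.exact t|
      ≤ ((t.leaves.length : ℚ) - 1) * α.unitRoundoff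
        / (1 + ((t.leaves.length : ℚ) - 1) * α.unitRoundoff) * absSum t :=
  le_trans (abs_eval_sub_exact_le (flα α) t) (absErr_flα_le_langeRump hα t ht hk)

/-- The constant sharpens Jeannerod–Rump's: `k·u/(1+k·u) ≤ k·u/(1+u)` for `k ≥ 1`. [folklore] -/
theorem langeRump_le_jeannerodRump {k u : ℚ} (hk : 1 ≤ k) (hu : 0 ≤ u) :
    k * u / (1 + k * u) ≤ k * u / (1 + u) :=
  div_le_div_of_nonneg_left (by nlinarith) (by linarith) (by nlinarith)

/-- ATTAINED (kernel, bfloat16, `u = 2^-8`, `n = 4 ≤ ½u⁻¹ + 1`): recursive summation of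
`(1, u, u, u)` with ties-to-even evaluates to `1` (each `1 + u` ties back to `1`), the exact sum
is `1 + 3u = Σ|xᵢ|`, so `|ŝ - s| = 3u = 3u/(1+3u)·Σ|xᵢ|` — equality in the theorem.
[cite: BoldoEtAl2023, Thm 4.5] -/
theorem langeRump_attained_BFloat16 :
    SumTree.eval (flα Format.BFloat16)
        (.node (.node (.node (.leaf 1) (.leaf (1/256))) (.leaf (1/256))) (.leaf (1/256))) = 1 ∧
    SumTree.exact
        (.node (.node (.node (.leaf 1) (.leaf (1/256))) (.leaf (1/256))) (.leaf (1/256)))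
      = 1 + 3/256 ∧
    absSum (.node (.node (.node (.leaf 1) (.leaf (1/256))) (.leaf (1/256))) (.leaf (1/256)))
      = 1 + 3/256 ∧
    |(1 : ℚ) - (1 + 3/256)| = 3 * (1/256) / (1 + 3 * (1/256)) * (1 + 3/256) := by
  refine ⟨by decide +kernel, by decide +kernel, by decide +kernel, by norm_num⟩

/-! ### Recursive summation (`seqSum`) as the left comb: the sequential corollary -/

/-- The left comb over `x 0 … x k` evaluates to the sequential accumulation `seqSum α x k`
(first term a value of `α`). [folklore] -/
theorem eval_combTree_eq_seqSum (x : ℕ → ℚ) (h0 : ∃ y : MiniFloat α, y.toRat = x 0) :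
    ∀ k, SumTree.eval (flα α) (combTree x k) = (seqSum α x k).toRat
  | 0 => by
      simp only [combTree, SumTree.eval, seqSum]
      exact (toRat_roundNE_of_exists h0).symm
  | k + 1 => by
      rw [combTree, SumTree.eval, eval_combTree_eq_seqSum x h0 k]
      rfl

/-- `InRange` data make the comb an in-range evaluation tree. [folklore] -/
theorem treeInRange_combTree (x : ℕ → ℚ) :
    ∀ n, (∀ i ≤ n, ∃ y : MiniFloat α, y.toRat = x i) → InRange α x n →
      TreeInRange α (combTree x n)
  | 0, hx, _ => hx 0 le_rfl
  | n + 1, hx, hr => by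
      refine ⟨treeInRange_combTree x n (fun i hi => hx i (Nat.le_succ_of_le hi))
        ⟨hr.1, fun k hk => hr.2 k (Nat.lt_succ_of_lt hk)⟩, hx (n + 1) le_rfl, ?_⟩
      rw [eval_combTree_eq_seqSum x (hx 0 (Nat.zero_le _)) n, SumTree.eval]
      exact hr.2 n (Nat.lt_succ_self n)

/-- LANGE–RUMP, SEQUENTIAL FORM (the cell's `seqSum`): inputs `x 0 … x n` values of `α`
(`emaxCode ≥ 2`), every step in range, `n ≤ ½u⁻¹` additions ⟹
`|ŝₙ - Σ_{i≤n} xᵢ| ≤ n·u/(1 + n·u) · Σ_{i≤n} |xᵢ|` — the exact worst case of recursive summation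
(attained by `(1, u, …, u)`), i.e. the GEMM note's `W(n+1) ≤ n u/(1+n u)` for every format.
[cite: BoldoEtAl2023, Thm 4.5] -/
theorem abs_seqSum_sub_sum_le_langeRump (hα : 2 ≤ α.emaxCode) (x : ℕ → ℚ) (n : ℕ)
    (hx : ∀ i ≤ n, ∃ y : MiniFloat α, y.toRat = x i) (hr : InRange α x n)
    (hn : 2 * (n : ℚ) * α.unitRoundoff ≤ 1) :
    |(seqSum α x n).toRat - ∑ i ∈ Finset.range (n + 1), x i|
      ≤ (n : ℚ) * α.unitRoundoff / (1 + (n : ℚ) * α.unitRoundoff)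
        * ∑ i ∈ Finset.range (n + 1), |x i| := by
  have ht := treeInRange_combTree (α := α) x n hx hr
  have hlen : (((combTree x n).leaves.length : ℕ) : ℚ) - 1 = n := by
    rw [length_leaves_combTree]; push_cast; ring
  have := abs_eval_sub_exact_le_langeRump hα (combTree x n) ht (by rw [hlen]; exact hn)
  rw [hlen, eval_combTree_eq_seqSum x (hx 0 (Nat.zero_le _)) n, exact_combTree,
    absSum_combTree] at this
  exact this

end MiniFloat

end Literature.ComputerArithmetic.FloatingPoint
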